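import Summits.BirchSwinnertonDyer.Rank1Residual.X11a.VisibilityRecordsNoRam
import Summits.BirchSwinnertonDyer.Rank1Residual.X11a.VisibilityRecords5
import Summits.BirchSwinnertonDyer.Rank1Residual.X11a.VisibilityRecords9
import Summits.BirchSwinnertonDyer.Rank1Residual.X11a.VisibilityRecords10
import Summits.BirchSwinnertonDyer.Rank1Residual.X11b.MultiplicativeSurjectivity
import Summits.BirchSwinnertonDyer.Rank1Residual.X11b.CertificateCheckBridge
import Literature.NumberTheory.EllipticCurves.OrdinaryPrimesProofs
import Literature.NumberTheory.EllipticCurves.LFunctionPrimeCoeff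
import Literature.NumberTheory.DiophantineGeometry.LocalReduction
import HarnessLib

/-!
# Class X11a — per-pair VISIBILITY records with the CLASS ATOMS in the kernel, file 4
# (cell `bsd-print-x11a`, seat p4)

HONEST FRAMING (cells `b2b-bsdres` / `bsd-print-x11a`, verbatim): the goal is to DELETE the
COMBINATION-SHAPED residual classes of the Birch–Swinnerton-Dyer formula for ALL analytic-rank
`≤ 1` elliptic curves over `ℚ` — "full BSD formula for every rank `≤ 1` curve in class `C`"
assembled STRICTLY from published theorems — so that the rank-`≤ 1` remainder becomes exactly the
CONSTRUCTION-SHAPED classes, which are TYPED (missing-input `Prop`s), NOT attempted. This is not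
"finishing BSD". PER PAIR: theorems only, no definition, no named fact; nothing is booked by this
file and no class label changes (referee / planner).

## What

For every record `bsdp<p>_v<label>` of `X11a/VisibilityRecords1…32.lean` (94 rank-`0` X11-type
pairs of the x11a gen-9 census) this file discharges the displayed class binder `hX : ClassX11a W p`
IN THE KERNEL up to the analytic rank: `classX11a_c<label> : W = ⟨…⟩ → W.analyticRank = 0 →
ClassX11a W p` — `p ∥ N` from the integral model (`p ∣ Δ`, `p ∤ c₄`; Silverman VII.5.1 (b)),
`E[p]` irreducible by a Frobenius witness (a good prime `ℓ` with `X² − a_ℓ X + ℓ` irreducible mod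
`p`, `a_ℓ` from the kernel point count `countPoints`; Mazur 1978 Prop. 6.3 (1), tree
`hasIrreducibleModPGaloisRep_of_intModel_of_noroot`), and NO (ram) prime by `not_ram_of_intModel`
(`X11a/VisibilityRecordsNoRam.lean`: every prime of `Δ` is `p`, additive, or multiplicative with `p ∣ ord_ℓ Δ`) — and restates the
record as `bsdp<p>_a<label>` with `hr : W.analyticRank = 0` in place of `hX`, the image bit
`ρ̄_{E,p}` onto in the kernel wherever `E` is très ramifié at `p` (x11c's `ClassX11a.surj_of_not_dvd`).
Displayed binders LEFT per record: `hr` (`r_an = 0`, Cremona `allbsd`), `hq`/`hv` (`#Ш_an = p²`),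
`θ`/`hθ` (the `p`-congruence, Sturm two-engine, x11a g9), `hrank` (`rank F(ℚ) = 2`, Cremona),
and `hsurj` only at the peu ramifié rows.

References: [SilvermanAEC2009] VII.5.1; [Mazur1978] Prop. 6.3; [SerreInventiones1972] §2.4 Prop. 15;
[Wuthrich2014] Prop. 21; [CremonaMazur2000] §3; [Miller2011LMS] Def. 1.1; [Cremona2006];
`X11a/VisibilityRecords1.lean` (template); HOME `run/shared/lean/pub/bsd-print-x11a/P4-RECORDS-TABLE.md`.
-/

set_option autoImplicit false

noncomputable section

open scoped Classical

open WeierstrassCurve Literature.NumberTheory.EllipticCurves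
  Literature.NumberTheory.EllipticCurves.Rank1Residual
  Literature.NumberTheory.EllipticCurves.Rank1Residual.Typed
  Literature.NumberTheory.EllipticCurves.Rank1Residual.X11RankOneCertificates
  Literature.NumberTheory.EllipticCurves.Wuthrich2014
  NumberField IsDedekindDomain Rat.HeightOneSpectrum
  Summit.BirchSwinnertonDyer.BirchSwinnertonDyer.Rank1Residual.IntModel

namespace Summit.BirchSwinnertonDyer.Rank1Residual.X11a.VisibilityRecords

/-! ### `121680ei1 @ 5` -/

/-- **`121680ei1 = [0, 0, 0, -546611403, -4737555360902]` lies in class X11a at `5`, in the KERNEL up to `r_an = 0`**: `5 ∥ N`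
(`5 ∣ Δ = ±2³⁰·3¹²·5³·13⁹`, `5 ∤ c₄`: multiplicative, Silverman VII.5.1 (b)); `E[5]` irreducible by the
Frobenius witness `ℓ = 7` (`#Ẽ(𝔽_7) = 8`, `a_7 = 0`, `X² − a_7X + 7` has no root mod `5`;
Mazur 1978 Prop. 6.3 (1)); no (ram) prime (`2` additive; `3` additive; `5 = p`; `13` additive). Displayed: `hr` (`r_an = 0`, Cremona).
[cite: SilvermanAEC2009, VII.5 Prop. 5.1] [cite: Mazur1978, §6 Prop. 6.3 (1) (p. 153)] [cite: Cremona2006, Table 1 (Cremona label 121680ei1)] -/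
theorem classX11a_c121680ei1 (W : WeierstrassCurve ℚ) [W.IsElliptic] [W.IsGloballyMinimal] [Fact (Nat.Prime 5)]
    (hWeq : W = ⟨0, 0, 0, -546611403, -4737555360902⟩) (hr : W.analyticRank = 0) : ClassX11a W 5 := by
  haveI : Fact (Nat.Prime 2) := ⟨Nat.prime_two⟩
  haveI : Fact (Nat.Prime 3) := ⟨Nat.prime_three⟩
  haveI : Fact (Nat.Prime 7) := ⟨by norm_num⟩
  haveI : Fact (Nat.Prime 13) := ⟨by norm_num⟩
  have hI : integralModelInt W = ⟨0, 0, 0, -546611403, -4737555360902⟩ := by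
    subst hWeq; exact integralModelInt_eq_of_map_eq _ (map_mk_int 0 0 0 (-546611403) (-4737555360902))
  have hmult : Mult W 5 :=
    hasMultiplicativeReductionAtPrime_of_intModel hI 5 (by decide +kernel) (by decide +kernel)
  have hirr : Irr W 5 := by
    have hc : Nat.card (((⟨0, 0, 0, -546611403, -4737555360902⟩ : WeierstrassCurve ℤ).map
        (Int.castRingHom (ZMod 7))).toAffine.Point) = 8 := by
      have h := X11b.natCard_point_eq_countPoints 0 0 0 (-546611403) (-4737555360902) 7 (by norm_num)
        (by decide +kernel)
      have h' : countPoints [0, 0, 0, -546611403, -4737555360902] 7 = 8 := by decide +kernel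
      exact_mod_cast h.trans h'
    exact hasIrreducibleModPGaloisRep_of_intModel_of_noroot (hp := ⟨by norm_num⟩) (hℓ := ⟨by norm_num⟩)
      hI 5 7 (by norm_num) (by decide +kernel) hc (by decide)
  have hnram : ¬ Ram W 5 := not_ram_of_intModel hI 5 [2, 3, 5, 13] [30, 12, 3, 9]
    (by intro q hq; simp only [List.mem_cons, List.mem_nil_iff, or_false] at hq
        rcases hq with rfl | rfl | rfl | rfl <;> norm_num) (by decide +kernel)
    (by intro ℓ hℓ; simp only [List.mem_cons, List.mem_nil_iff, or_false] at hℓ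
        rcases hℓ with rfl | rfl | rfl | rfl
        · exact Or.inr (Or.inl (by decide +kernel))
        · exact Or.inr (Or.inl (by decide +kernel))
        · exact Or.inl rfl
        · exact Or.inr (Or.inl (by decide +kernel)))
  exact ⟨hr, by decide, hmult, hirr, hnram⟩

/-- **`121680ei1 @ 5`: `BSD(E,5)` with the class atoms in the kernel** — `bsdp5_v121680ei1`
(`X11a/VisibilityRecords5.lean`) with `hX` supplied by `classX11a_c121680ei1`; image bit in the kernel (très ramifié, `ClassX11a.surj_of_not_dvd`). Displayed binders
left: `hr` (`r_an = 0`), `hq`/`hv` (`#Ш_an = 25`), `θ`/`hθ` (the `5`-congruence), `hrank` (`rank F(ℚ) = 2`).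
PER PAIR; nothing booked. [cite: Wuthrich2014, Prop. 21 (p. 400)] [cite: CremonaMazur2000, §3 and Table 1]
[cite: Cremona2006, Table 1 (Cremona label 121680ei1)] -/
theorem bsdp5_a121680ei1 (hCT : exists_casselsTate_pairing (K := ℚ)) (hW : sha_dvd_analyticSha)
    (hGZK : rank_eq_analyticRank_of_analyticRank_le_one) (hmod : hasEntireLFunction_rat)
    (W : WeierstrassCurve ℚ) [W.IsElliptic] [W.IsGloballyMinimal] [Fact (Nat.Prime 5)]
    (hWeq : W = ⟨0, 0, 0, -546611403, -4737555360902⟩) (hr : W.analyticRank = 0)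
    {q : ℚ} (hq : shaAn W = (q : ℂ)) (hv : padicValRat 5 q ≤ 2)
    (W' : WeierstrassCurve ℚ) (hW' : W' = ⟨0, 0, 0, -6123, 196378⟩) [W'.IsElliptic]
    (θ : geomTorsion W' ((5 : ℕ) : ℤ) ≃+ geomTorsion W ((5 : ℕ) : ℤ))
    (hθ : ∀ (σ : Field.absoluteGaloisGroup ℚ) (P : geomTorsion W' ((5 : ℕ) : ℤ)),
      θ (σ • P) = σ • θ P)
    (hrank : 2 ≤ W'.mordellWeilRank) : BSDp W 5 := by
  have hX : ClassX11a W 5 := classX11a_c121680ei1 W hWeq hr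
  have hsurj : Surj W 5 := ClassX11a.surj_of_not_dvd W 5 hX (by
    rw [minimalDiscriminantInt_eq (integralModelInt_eq_of_map_eq (W := W) _ (by rw [hWeq]; exact map_mk_int 0 0 0 (-546611403) (-4737555360902))),
      padicValInt_eq_of_dvd_of_not_dvd 5 (e := 3) (by decide +kernel) (by decide +kernel)]
    decide)
  exact bsdp5_v121680ei1 hCT hW hGZK hmod W hWeq hX hsurj hq hv W' hW' θ hθ hrank

/-! ### `121680ei2 @ 5` -/

/-- **`121680ei2 = [0, 0, 0, 263290677, -17576285113478]` lies in class X11a at `5`, in the KERNEL up to `r_an = 0`**: `5 ∥ N`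
(`5 ∣ Δ = ±2²¹·3¹⁸·5⁶·13⁹`, `5 ∤ c₄`: multiplicative, Silverman VII.5.1 (b)); `E[5]` irreducible by the
Frobenius witness `ℓ = 7` (`#Ẽ(𝔽_7) = 8`, `a_7 = 0`, `X² − a_7X + 7` has no root mod `5`;
Mazur 1978 Prop. 6.3 (1)); no (ram) prime (`2` additive; `3` additive; `5 = p`; `13` additive). Displayed: `hr` (`r_an = 0`, Cremona).
[cite: SilvermanAEC2009, VII.5 Prop. 5.1] [cite: Mazur1978, §6 Prop. 6.3 (1) (p. 153)] [cite: Cremona2006, Table 1 (Cremona label 121680ei2)] -/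
theorem classX11a_c121680ei2 (W : WeierstrassCurve ℚ) [W.IsElliptic] [W.IsGloballyMinimal] [Fact (Nat.Prime 5)]
    (hWeq : W = ⟨0, 0, 0, 263290677, -17576285113478⟩) (hr : W.analyticRank = 0) : ClassX11a W 5 := by
  haveI : Fact (Nat.Prime 2) := ⟨Nat.prime_two⟩
  haveI : Fact (Nat.Prime 3) := ⟨Nat.prime_three⟩
  haveI : Fact (Nat.Prime 7) := ⟨by norm_num⟩
  haveI : Fact (Nat.Prime 13) := ⟨by norm_num⟩
  have hI : integralModelInt W = ⟨0, 0, 0, 263290677, -17576285113478⟩ := by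
    subst hWeq; exact integralModelInt_eq_of_map_eq _ (map_mk_int 0 0 0 263290677 (-17576285113478))
  have hmult : Mult W 5 :=
    hasMultiplicativeReductionAtPrime_of_intModel hI 5 (by decide +kernel) (by decide +kernel)
  have hirr : Irr W 5 := by
    have hc : Nat.card (((⟨0, 0, 0, 263290677, -17576285113478⟩ : WeierstrassCurve ℤ).map
        (Int.castRingHom (ZMod 7))).toAffine.Point) = 8 := by
      have h := X11b.natCard_point_eq_countPoints 0 0 0 263290677 (-17576285113478) 7 (by norm_num)
        (by decide +kernel)
      have h' : countPoints [0, 0, 0, 263290677, -17576285113478] 7 = 8 := by decide +kernel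
      exact_mod_cast h.trans h'
    exact hasIrreducibleModPGaloisRep_of_intModel_of_noroot (hp := ⟨by norm_num⟩) (hℓ := ⟨by norm_num⟩)
      hI 5 7 (by norm_num) (by decide +kernel) hc (by decide)
  have hnram : ¬ Ram W 5 := not_ram_of_intModel hI 5 [2, 3, 5, 13] [21, 18, 6, 9]
    (by intro q hq; simp only [List.mem_cons, List.mem_nil_iff, or_false] at hq
        rcases hq with rfl | rfl | rfl | rfl <;> norm_num) (by decide +kernel)
    (by intro ℓ hℓ; simp only [List.mem_cons, List.mem_nil_iff, or_false] at hℓ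
        rcases hℓ with rfl | rfl | rfl | rfl
        · exact Or.inr (Or.inl (by decide +kernel))
        · exact Or.inr (Or.inl (by decide +kernel))
        · exact Or.inl rfl
        · exact Or.inr (Or.inl (by decide +kernel)))
  exact ⟨hr, by decide, hmult, hirr, hnram⟩

/-- **`121680ei2 @ 5`: `BSD(E,5)` with the class atoms in the kernel** — `bsdp5_v121680ei2`
(`X11a/VisibilityRecords5.lean`) with `hX` supplied by `classX11a_c121680ei2`; image bit in the kernel (très ramifié, `ClassX11a.surj_of_not_dvd`). Displayed binders
left: `hr` (`r_an = 0`), `hq`/`hv` (`#Ш_an = 25`), `θ`/`hθ` (the `5`-congruence), `hrank` (`rank F(ℚ) = 2`).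
PER PAIR; nothing booked. [cite: Wuthrich2014, Prop. 21 (p. 400)] [cite: CremonaMazur2000, §3 and Table 1]
[cite: Cremona2006, Table 1 (Cremona label 121680ei2)] -/
theorem bsdp5_a121680ei2 (hCT : exists_casselsTate_pairing (K := ℚ)) (hW : sha_dvd_analyticSha)
    (hGZK : rank_eq_analyticRank_of_analyticRank_le_one) (hmod : hasEntireLFunction_rat)
    (W : WeierstrassCurve ℚ) [W.IsElliptic] [W.IsGloballyMinimal] [Fact (Nat.Prime 5)]
    (hWeq : W = ⟨0, 0, 0, 263290677, -17576285113478⟩) (hr : W.analyticRank = 0)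
    {q : ℚ} (hq : shaAn W = (q : ℂ)) (hv : padicValRat 5 q ≤ 2)
    (W' : WeierstrassCurve ℚ) (hW' : W' = ⟨0, 0, 0, -6123, 196378⟩) [W'.IsElliptic]
    (θ : geomTorsion W' ((5 : ℕ) : ℤ) ≃+ geomTorsion W ((5 : ℕ) : ℤ))
    (hθ : ∀ (σ : Field.absoluteGaloisGroup ℚ) (P : geomTorsion W' ((5 : ℕ) : ℤ)),
      θ (σ • P) = σ • θ P)
    (hrank : 2 ≤ W'.mordellWeilRank) : BSDp W 5 := by
  have hX : ClassX11a W 5 := classX11a_c121680ei2 W hWeq hr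
  have hsurj : Surj W 5 := ClassX11a.surj_of_not_dvd W 5 hX (by
    rw [minimalDiscriminantInt_eq (integralModelInt_eq_of_map_eq (W := W) _ (by rw [hWeq]; exact map_mk_int 0 0 0 263290677 (-17576285113478))),
      padicValInt_eq_of_dvd_of_not_dvd 5 (e := 6) (by decide +kernel) (by decide +kernel)]
    decide)
  exact bsdp5_v121680ei2 hCT hW hGZK hmod W hWeq hX hsurj hq hv W' hW' θ hθ hrank

/-! ### `126405o1 @ 5` -/

/-- **`126405o1 = [1, -1, 0, -1479465, 1398711046]` lies in class X11a at `5`, in the KERNEL up to `r_an = 0`**: `5 ∥ N`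
(`5 ∣ Δ = ±3⁶·5·53¹⁰`, `5 ∤ c₄`: multiplicative, Silverman VII.5.1 (b)); `E[5]` irreducible by the
Frobenius witness `ℓ = 11` (`#Ẽ(𝔽_11) = 16`, `a_11 = -4`, `X² − a_11X + 11` has no root mod `5`;
Mazur 1978 Prop. 6.3 (1)); no (ram) prime (`3` additive; `5 = p`; `53` additive). Displayed: `hr` (`r_an = 0`, Cremona).
[cite: SilvermanAEC2009, VII.5 Prop. 5.1] [cite: Mazur1978, §6 Prop. 6.3 (1) (p. 153)] [cite: Cremona2006, Table 1 (Cremona label 126405o1)] -/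
theorem classX11a_c126405o1 (W : WeierstrassCurve ℚ) [W.IsElliptic] [W.IsGloballyMinimal] [Fact (Nat.Prime 5)]
    (hWeq : W = ⟨1, -1, 0, -1479465, 1398711046⟩) (hr : W.analyticRank = 0) : ClassX11a W 5 := by
  haveI : Fact (Nat.Prime 3) := ⟨Nat.prime_three⟩
  haveI : Fact (Nat.Prime 11) := ⟨by norm_num⟩
  haveI : Fact (Nat.Prime 53) := ⟨by norm_num⟩
  have hI : integralModelInt W = ⟨1, -1, 0, -1479465, 1398711046⟩ := by
    subst hWeq; exact integralModelInt_eq_of_map_eq _ (map_mk_int 1 (-1) 0 (-1479465) 1398711046)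
  have hmult : Mult W 5 :=
    hasMultiplicativeReductionAtPrime_of_intModel hI 5 (by decide +kernel) (by decide +kernel)
  have hirr : Irr W 5 := by
    have hc : Nat.card (((⟨1, -1, 0, -1479465, 1398711046⟩ : WeierstrassCurve ℤ).map
        (Int.castRingHom (ZMod 11))).toAffine.Point) = 16 := by
      have h := X11b.natCard_point_eq_countPoints 1 (-1) 0 (-1479465) 1398711046 11 (by norm_num)
        (by decide +kernel)
      have h' : countPoints [1, -1, 0, -1479465, 1398711046] 11 = 16 := by decide +kernel
      exact_mod_cast h.trans h'
    exact hasIrreducibleModPGaloisRep_of_intModel_of_noroot (hp := ⟨by norm_num⟩) (hℓ := ⟨by norm_num⟩)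
      hI 5 11 (by norm_num) (by decide +kernel) hc (by decide)
  have hnram : ¬ Ram W 5 := not_ram_of_intModel hI 5 [3, 5, 53] [6, 1, 10]
    (by intro q hq; simp only [List.mem_cons, List.mem_nil_iff, or_false] at hq
        rcases hq with rfl | rfl | rfl <;> norm_num) (by decide +kernel)
    (by intro ℓ hℓ; simp only [List.mem_cons, List.mem_nil_iff, or_false] at hℓ
        rcases hℓ with rfl | rfl | rfl
        · exact Or.inr (Or.inl (by decide +kernel))
        · exact Or.inl rfl
        · exact Or.inr (Or.inl (by decide +kernel)))
  exact ⟨hr, by decide, hmult, hirr, hnram⟩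

/-- **`126405o1 @ 5`: `BSD(E,5)` with the class atoms in the kernel** — `bsdp5_v126405o1`
(`X11a/VisibilityRecords9.lean`) with `hX` supplied by `classX11a_c126405o1`; image bit in the kernel (très ramifié, `ClassX11a.surj_of_not_dvd`). Displayed binders
left: `hr` (`r_an = 0`), `hq`/`hv` (`#Ш_an = 25`), `θ`/`hθ` (the `5`-congruence), `hrank` (`rank F(ℚ) = 2`).
PER PAIR; nothing booked. [cite: Wuthrich2014, Prop. 21 (p. 400)] [cite: CremonaMazur2000, §3 and Table 1]
[cite: Cremona2006, Table 1 (Cremona label 126405o1)] -/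
theorem bsdp5_a126405o1 (hCT : exists_casselsTate_pairing (K := ℚ)) (hW : sha_dvd_analyticSha)
    (hGZK : rank_eq_analyticRank_of_analyticRank_le_one) (hmod : hasEntireLFunction_rat)
    (W : WeierstrassCurve ℚ) [W.IsElliptic] [W.IsGloballyMinimal] [Fact (Nat.Prime 5)]
    (hWeq : W = ⟨1, -1, 0, -1479465, 1398711046⟩) (hr : W.analyticRank = 0)
    {q : ℚ} (hq : shaAn W = (q : ℂ)) (hv : padicValRat 5 q ≤ 2)
    (W' : WeierstrassCurve ℚ) (hW' : W' = ⟨1, -1, 0, -15075, -236250⟩) [W'.IsElliptic]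
    (θ : geomTorsion W' ((5 : ℕ) : ℤ) ≃+ geomTorsion W ((5 : ℕ) : ℤ))
    (hθ : ∀ (σ : Field.absoluteGaloisGroup ℚ) (P : geomTorsion W' ((5 : ℕ) : ℤ)),
      θ (σ • P) = σ • θ P)
    (hrank : 2 ≤ W'.mordellWeilRank) : BSDp W 5 := by
  have hX : ClassX11a W 5 := classX11a_c126405o1 W hWeq hr
  have hsurj : Surj W 5 := ClassX11a.surj_of_not_dvd W 5 hX (by
    rw [minimalDiscriminantInt_eq (integralModelInt_eq_of_map_eq (W := W) _ (by rw [hWeq]; exact map_mk_int 1 (-1) 0 (-1479465) 1398711046)),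
      padicValInt_eq_of_dvd_of_not_dvd 5 (e := 1) (by decide +kernel) (by decide +kernel)]
    decide)
  exact bsdp5_v126405o1 hCT hW hGZK hmod W hWeq hX hsurj hq hv W' hW' θ hθ hrank

/-! ### `141120ek1 @ 5` -/

/-- **`141120ek1 = [0, 0, 0, -705668943, -7126549533992]` lies in class X11a at `5`, in the KERNEL up to `r_an = 0`**: `5 ∥ N`
(`5 ∣ Δ = ±2⁶·3³⁴·5⁴·7⁷`, `5 ∤ c₄`: multiplicative, Silverman VII.5.1 (b)); `E[5]` irreducible by the
Frobenius witness `ℓ = 11` (`#Ẽ(𝔽_11) = 8`, `a_11 = 4`, `X² − a_11X + 11` has no root mod `5`;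
Mazur 1978 Prop. 6.3 (1)); no (ram) prime (`2` additive; `3` additive; `5 = p`; `7` additive). Displayed: `hr` (`r_an = 0`, Cremona).
[cite: SilvermanAEC2009, VII.5 Prop. 5.1] [cite: Mazur1978, §6 Prop. 6.3 (1) (p. 153)] [cite: Cremona2006, Table 1 (Cremona label 141120ek1)] -/
theorem classX11a_c141120ek1 (W : WeierstrassCurve ℚ) [W.IsElliptic] [W.IsGloballyMinimal] [Fact (Nat.Prime 5)]
    (hWeq : W = ⟨0, 0, 0, -705668943, -7126549533992⟩) (hr : W.analyticRank = 0) : ClassX11a W 5 := by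
  haveI : Fact (Nat.Prime 2) := ⟨Nat.prime_two⟩
  haveI : Fact (Nat.Prime 3) := ⟨Nat.prime_three⟩
  haveI : Fact (Nat.Prime 7) := ⟨by norm_num⟩
  haveI : Fact (Nat.Prime 11) := ⟨by norm_num⟩
  have hI : integralModelInt W = ⟨0, 0, 0, -705668943, -7126549533992⟩ := by
    subst hWeq; exact integralModelInt_eq_of_map_eq _ (map_mk_int 0 0 0 (-705668943) (-7126549533992))
  have hmult : Mult W 5 :=
    hasMultiplicativeReductionAtPrime_of_intModel hI 5 (by decide +kernel) (by decide +kernel)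
  have hirr : Irr W 5 := by
    have hc : Nat.card (((⟨0, 0, 0, -705668943, -7126549533992⟩ : WeierstrassCurve ℤ).map
        (Int.castRingHom (ZMod 11))).toAffine.Point) = 8 := by
      have h := X11b.natCard_point_eq_countPoints 0 0 0 (-705668943) (-7126549533992) 11 (by norm_num)
        (by decide +kernel)
      have h' : countPoints [0, 0, 0, -705668943, -7126549533992] 11 = 8 := by decide +kernel
      exact_mod_cast h.trans h'
    exact hasIrreducibleModPGaloisRep_of_intModel_of_noroot (hp := ⟨by norm_num⟩) (hℓ := ⟨by norm_num⟩)
      hI 5 11 (by norm_num) (by decide +kernel) hc (by decide)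
  have hnram : ¬ Ram W 5 := not_ram_of_intModel hI 5 [2, 3, 5, 7] [6, 34, 4, 7]
    (by intro q hq; simp only [List.mem_cons, List.mem_nil_iff, or_false] at hq
        rcases hq with rfl | rfl | rfl | rfl <;> norm_num) (by decide +kernel)
    (by intro ℓ hℓ; simp only [List.mem_cons, List.mem_nil_iff, or_false] at hℓ
        rcases hℓ with rfl | rfl | rfl | rfl
        · exact Or.inr (Or.inl (by decide +kernel))
        · exact Or.inr (Or.inl (by decide +kernel))
        · exact Or.inl rfl
        · exact Or.inr (Or.inl (by decide +kernel)))
  exact ⟨hr, by decide, hmult, hirr, hnram⟩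

/-- **`141120ek1 @ 5`: `BSD(E,5)` with the class atoms in the kernel** — `bsdp5_v141120ek1`
(`X11a/VisibilityRecords10.lean`) with `hX` supplied by `classX11a_c141120ek1`; image bit in the kernel (très ramifié, `ClassX11a.surj_of_not_dvd`). Displayed binders
left: `hr` (`r_an = 0`), `hq`/`hv` (`#Ш_an = 25`), `θ`/`hθ` (the `5`-congruence), `hrank` (`rank F(ℚ) = 2`).
PER PAIR; nothing booked. [cite: Wuthrich2014, Prop. 21 (p. 400)] [cite: CremonaMazur2000, §3 and Table 1]
[cite: Cremona2006, Table 1 (Cremona label 141120ek1)] -/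
theorem bsdp5_a141120ek1 (hCT : exists_casselsTate_pairing (K := ℚ)) (hW : sha_dvd_analyticSha)
    (hGZK : rank_eq_analyticRank_of_analyticRank_le_one) (hmod : hasEntireLFunction_rat)
    (W : WeierstrassCurve ℚ) [W.IsElliptic] [W.IsGloballyMinimal] [Fact (Nat.Prime 5)]
    (hWeq : W = ⟨0, 0, 0, -705668943, -7126549533992⟩) (hr : W.analyticRank = 0)
    {q : ℚ} (hq : shaAn W = (q : ℂ)) (hv : padicValRat 5 q ≤ 2)
    (W' : WeierstrassCurve ℚ) (hW' : W' = ⟨0, 0, 0, -148323, 23466688⟩) [W'.IsElliptic]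
    (θ : geomTorsion W' ((5 : ℕ) : ℤ) ≃+ geomTorsion W ((5 : ℕ) : ℤ))
    (hθ : ∀ (σ : Field.absoluteGaloisGroup ℚ) (P : geomTorsion W' ((5 : ℕ) : ℤ)),
      θ (σ • P) = σ • θ P)
    (hrank : 2 ≤ W'.mordellWeilRank) : BSDp W 5 := by
  have hX : ClassX11a W 5 := classX11a_c141120ek1 W hWeq hr
  have hsurj : Surj W 5 := ClassX11a.surj_of_not_dvd W 5 hX (by
    rw [minimalDiscriminantInt_eq (integralModelInt_eq_of_map_eq (W := W) _ (by rw [hWeq]; exact map_mk_int 0 0 0 (-705668943) (-7126549533992))),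
      padicValInt_eq_of_dvd_of_not_dvd 5 (e := 4) (by decide +kernel) (by decide +kernel)]
    decide)
  exact bsdp5_v141120ek1 hCT hW hGZK hmod W hWeq hX hsurj hq hv W' hW' θ hθ hrank

/-! ### `141120ek2 @ 5` -/

/-- **`141120ek2 = [0, 0, 0, -11252115588, -459408804615488]` lies in class X11a at `5`, in the KERNEL up to `r_an = 0`**: `5 ∥ N`
(`5 ∣ Δ = ±2¹²·3²⁰·5⁸·7⁸`, `5 ∤ c₄`: multiplicative, Silverman VII.5.1 (b)); `E[5]` irreducible by the
Frobenius witness `ℓ = 11` (`#Ẽ(𝔽_11) = 8`, `a_11 = 4`, `X² − a_11X + 11` has no root mod `5`;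
Mazur 1978 Prop. 6.3 (1)); no (ram) prime (`2` additive; `3` additive; `5 = p`; `7` additive). Displayed: `hr` (`r_an = 0`, Cremona).
[cite: SilvermanAEC2009, VII.5 Prop. 5.1] [cite: Mazur1978, §6 Prop. 6.3 (1) (p. 153)] [cite: Cremona2006, Table 1 (Cremona label 141120ek2)] -/
theorem classX11a_c141120ek2 (W : WeierstrassCurve ℚ) [W.IsElliptic] [W.IsGloballyMinimal] [Fact (Nat.Prime 5)]
    (hWeq : W = ⟨0, 0, 0, -11252115588, -459408804615488⟩) (hr : W.analyticRank = 0) : ClassX11a W 5 := by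
  haveI : Fact (Nat.Prime 2) := ⟨Nat.prime_two⟩
  haveI : Fact (Nat.Prime 3) := ⟨Nat.prime_three⟩
  haveI : Fact (Nat.Prime 7) := ⟨by norm_num⟩
  haveI : Fact (Nat.Prime 11) := ⟨by norm_num⟩
  have hI : integralModelInt W = ⟨0, 0, 0, -11252115588, -459408804615488⟩ := by
    subst hWeq; exact integralModelInt_eq_of_map_eq _ (map_mk_int 0 0 0 (-11252115588) (-459408804615488))
  have hmult : Mult W 5 :=
    hasMultiplicativeReductionAtPrime_of_intModel hI 5 (by decide +kernel) (by decide +kernel)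
  have hirr : Irr W 5 := by
    have hc : Nat.card (((⟨0, 0, 0, -11252115588, -459408804615488⟩ : WeierstrassCurve ℤ).map
        (Int.castRingHom (ZMod 11))).toAffine.Point) = 8 := by
      have h := X11b.natCard_point_eq_countPoints 0 0 0 (-11252115588) (-459408804615488) 11 (by norm_num)
        (by decide +kernel)
      have h' : countPoints [0, 0, 0, -11252115588, -459408804615488] 11 = 8 := by decide +kernel
      exact_mod_cast h.trans h'
    exact hasIrreducibleModPGaloisRep_of_intModel_of_noroot (hp := ⟨by norm_num⟩) (hℓ := ⟨by norm_num⟩)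
      hI 5 11 (by norm_num) (by decide +kernel) hc (by decide)
  have hnram : ¬ Ram W 5 := not_ram_of_intModel hI 5 [2, 3, 5, 7] [12, 20, 8, 8]
    (by intro q hq; simp only [List.mem_cons, List.mem_nil_iff, or_false] at hq
        rcases hq with rfl | rfl | rfl | rfl <;> norm_num) (by decide +kernel)
    (by intro ℓ hℓ; simp only [List.mem_cons, List.mem_nil_iff, or_false] at hℓ
        rcases hℓ with rfl | rfl | rfl | rfl
        · exact Or.inr (Or.inl (by decide +kernel))
        · exact Or.inr (Or.inl (by decide +kernel))
        · exact Or.inl rfl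
        · exact Or.inr (Or.inl (by decide +kernel)))
  exact ⟨hr, by decide, hmult, hirr, hnram⟩

/-- **`141120ek2 @ 5`: `BSD(E,5)` with the class atoms in the kernel** — `bsdp5_v141120ek2`
(`X11a/VisibilityRecords10.lean`) with `hX` supplied by `classX11a_c141120ek2`; image bit in the kernel (très ramifié, `ClassX11a.surj_of_not_dvd`). Displayed binders
left: `hr` (`r_an = 0`), `hq`/`hv` (`#Ш_an = 25`), `θ`/`hθ` (the `5`-congruence), `hrank` (`rank F(ℚ) = 2`).
PER PAIR; nothing booked. [cite: Wuthrich2014, Prop. 21 (p. 400)] [cite: CremonaMazur2000, §3 and Table 1]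
[cite: Cremona2006, Table 1 (Cremona label 141120ek2)] -/
theorem bsdp5_a141120ek2 (hCT : exists_casselsTate_pairing (K := ℚ)) (hW : sha_dvd_analyticSha)
    (hGZK : rank_eq_analyticRank_of_analyticRank_le_one) (hmod : hasEntireLFunction_rat)
    (W : WeierstrassCurve ℚ) [W.IsElliptic] [W.IsGloballyMinimal] [Fact (Nat.Prime 5)]
    (hWeq : W = ⟨0, 0, 0, -11252115588, -459408804615488⟩) (hr : W.analyticRank = 0)
    {q : ℚ} (hq : shaAn W = (q : ℂ)) (hv : padicValRat 5 q ≤ 2)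
    (W' : WeierstrassCurve ℚ) (hW' : W' = ⟨0, 0, 0, -148323, 23466688⟩) [W'.IsElliptic]
    (θ : geomTorsion W' ((5 : ℕ) : ℤ) ≃+ geomTorsion W ((5 : ℕ) : ℤ))
    (hθ : ∀ (σ : Field.absoluteGaloisGroup ℚ) (P : geomTorsion W' ((5 : ℕ) : ℤ)),
      θ (σ • P) = σ • θ P)
    (hrank : 2 ≤ W'.mordellWeilRank) : BSDp W 5 := by
  have hX : ClassX11a W 5 := classX11a_c141120ek2 W hWeq hr
  have hsurj : Surj W 5 := ClassX11a.surj_of_not_dvd W 5 hX (by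
    rw [minimalDiscriminantInt_eq (integralModelInt_eq_of_map_eq (W := W) _ (by rw [hWeq]; exact map_mk_int 0 0 0 (-11252115588) (-459408804615488))),
      padicValInt_eq_of_dvd_of_not_dvd 5 (e := 8) (by decide +kernel) (by decide +kernel)]
    decide)
  exact bsdp5_v141120ek2 hCT hW hGZK hmod W hWeq hX hsurj hq hv W' hW' θ hθ hrank
end Summit.BirchSwinnertonDyer.Rank1Residual.X11a.VisibilityRecords

end
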